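import Summits.BirchSwinnertonDyer.Rank1Residual.X2.IntSeriesFirstUnitCoeff
import Summits.BirchSwinnertonDyer.Rank1Residual.X2.HidaLimitCongruenceAlgebra
import HarnessLib

/-!
# O9 (row B11), road H over the WIDE receptacle — the analytic Krull step on `𝓞_{ℂ_p}⟦T⟧` and the
# one-sided REVERSE congruence limit across `Λ → 𝓞_{ℂ_p}⟦T⟧` (cell `bsd-eis`, seat `bsd-eis-cgshw` g8;
# route `EisensteinPrimes`, crux 4 `BSDpOnCellC`, line b1; THEOREMS ONLY — companion of
# `X2/HidaLimitCongruenceAlgebra.lean` p428978 and `X2/HidaLimitRoadInt.lean` p429473)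

HONEST FRAMING (cell `bsd-eis`, run/shared/lean/pub/bsd-eis/): theorems only; no definition, no named
fact, no `sorry`; nothing about any curve; X2 stays CONSTRUCTION-SHAPED; no label or count moves.

* §1 (`CpIntSeries`): the receptacle `𝓞_{ℂ_p}⟦T⟧` of the non-split road of record (k5-c4, Hsieh 2014
  Thm. 1) is NOT Noetherian, so Krull's intersection theorem (`iInf_sup_pow_eq_self`, used over
  `R₀⟦T⟧` in p428978) is replaced by an analytic closedness lemma,
  **`mem_span_of_forall_mem_sup_pow`**: if `Q` has a (first) UNIT coefficient then
  `G ∈ (Q) + (p)^m` for every `m` forces `G ∈ (Q)` — the coefficientwise Gauss lemma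
  `norm_coeff_le_of_forall_norm_coeff_mul_le` (p420633) makes the quotients `p`-adically Cauchy,
  `ℂ_p` is complete and `𝓞_{ℂ_p}` closed, so the quotient converges and the division is exact. On road H
  the unit coefficient of `Q` is KY's D′♭ (`μ = 0`), the same input the closing step uses.
* §2 (`HidaLimitAlgebra`): **`C_pow_mul_map_mem_span_of_oneSided_congruences_int`** — from
  `(p)^a·(F) ⊆ Fitt_Λ(M)`, `e_m : M/p^m ≅ N_m/p^m` over `Λ`, `Fitt_Λ(N_m)·𝓞_{ℂ_p}⟦T⟧ ⊆ (Q_m)`,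
  `(Q_m) + (p)^m = (Q) + (p)^m` and a unit coefficient of `Q`: `C(p^a)·F♭ ∈ (Q)` — verbatim the body
  of `X2.HidaLimitRevDivOnTreeInt` (p429473). The Λ-side step is the ring-generic
  `map_fittingIdeal_le_sup_of_congruence` of p428978; only the limit changes.

References: Bosch–Güntzer–Remmert, *Non-Archimedean Analysis* §5.1.2 [BoschGuntzerRemmert1984];
C. Skinner, Pacific J. Math. 283 (2016) §3.1 [Skinner2016PacificMC]; Keller–Yin arXiv:2402.12781v2
§5.1 [KellerYin2024, PRE — shape only]; L. Washington, GTM 83, §7.1 [Washington1997].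
-/

set_option autoImplicit false

noncomputable section

open scoped Classical Topology

open Filter PowerSeries Literature.RingTheory.FittingIdeal Literature.NumberTheory.EllipticCurves
  Summit.BirchSwinnertonDyer.Rank1Residual.X11b

open Literature.NumberTheory.LFunctions.Dwork (norm_natCast_p_padicComplex mem_unitBall)

/-! ## §1 The analytic Krull step over `𝓞_{ℂ_p}⟦T⟧` -/

namespace Summit.BirchSwinnertonDyer.Rank1Residual.X2.CpIntSeries

variable {p : ℕ} [hp : Fact p.Prime]

/-- `‖p^m‖ = (p⁻¹)^m` in `ℂ_p` for the element `p^m ∈ 𝓞_{ℂ_p}`. [folklore] -/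
theorem norm_coe_natCast_p_pow (m : ℕ) :
    ‖((((p : ℕ) : 𝓞_ℂ_[p]) ^ m : 𝓞_ℂ_[p]) : ℂ_[p])‖ = ((p : ℝ)⁻¹) ^ m := by
  push_cast
  rw [norm_pow, norm_natCast_p_padicComplex]

/-- Unpacking `G ∈ (Q) + (p)^m`: `G = Q·H + p^m·R`. [folklore] -/
theorem exists_eq_mul_add_of_mem_sup_pow {Q G : PowerSeries 𝓞_ℂ_[p]} {m : ℕ}
    (h : G ∈ Ideal.span {Q} ⊔ Ideal.span {(C ((p : ℕ) : 𝓞_ℂ_[p]) : PowerSeries 𝓞_ℂ_[p])} ^ m) :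
    ∃ H R : PowerSeries 𝓞_ℂ_[p], G = Q * H + C (((p : ℕ) : 𝓞_ℂ_[p]) ^ m) * R := by
  rw [Ideal.span_singleton_pow, ← map_pow] at h
  obtain ⟨x, hx, y, hy, hxy⟩ := Submodule.mem_sup.mp h
  obtain ⟨H, rfl⟩ := Ideal.mem_span_singleton'.mp hx
  obtain ⟨R, rfl⟩ := Ideal.mem_span_singleton'.mp hy
  exact ⟨H, R, by rw [← hxy]; ring⟩

/-- Every coefficient of `C(p^m)·R` has norm `≤ (p⁻¹)^m`. [folklore] -/
theorem norm_coeff_C_pow_mul_le (R : PowerSeries 𝓞_ℂ_[p]) (m j : ℕ) :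
    ‖((coeff j (C (((p : ℕ) : 𝓞_ℂ_[p]) ^ m) * R) : 𝓞_ℂ_[p]) : ℂ_[p])‖ ≤ ((p : ℝ)⁻¹) ^ m := by
  rw [PowerSeries.coeff_C_mul, MulMemClass.coe_mul, norm_mul, norm_coe_natCast_p_pow]
  exact mul_le_of_le_one_right (pow_nonneg (inv_nonneg.mpr (Nat.cast_nonneg _)) _)
    (norm_coeff_le_one R j)

/-- A series all of whose coefficients have norm `≤ (p⁻¹)^m` for EVERY `m` is zero. [folklore] -/
theorem eq_zero_of_forall_norm_coeff_le_pow {S : PowerSeries 𝓞_ℂ_[p]}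
    (h : ∀ m j : ℕ, ‖((coeff j S : 𝓞_ℂ_[p]) : ℂ_[p])‖ ≤ ((p : ℝ)⁻¹) ^ m) : S = 0 := by
  have hp1 : ((p : ℝ)⁻¹) < 1 := inv_lt_one_of_one_lt₀ (by exact_mod_cast hp.out.one_lt)
  have hp0 : 0 ≤ ((p : ℝ)⁻¹) := inv_nonneg.mpr (Nat.cast_nonneg _)
  ext j
  rw [map_zero]
  by_contra hne
  have hpos : 0 < ‖((coeff j S : 𝓞_ℂ_[p]) : ℂ_[p])‖ := by
    rw [norm_pos_iff]
    intro h0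
    apply hne
    exact_mod_cast h0
  obtain ⟨m, hm⟩ := exists_pow_lt_of_lt_one hpos hp1
  exact (lt_irrefl _) ((h m j).trans_lt hm)

/-- **Coefficientwise limits in `𝓞_{ℂ_p}⟦T⟧`** (`ℂ_p` is complete, `𝓞_{ℂ_p}` is closed): a sequence of
series `H m` with `‖(H m' − H m)_j‖ ≤ (p⁻¹)^m` for all `j` and `m ≤ m'` has a limit `H∞` with
`‖(H∞ − H m)_j‖ ≤ (p⁻¹)^m`. [folklore] -/
theorem exists_limit_of_coeff_cauchy (H : ℕ → PowerSeries 𝓞_ℂ_[p])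
    (hH : ∀ m m' : ℕ, m ≤ m' → ∀ j : ℕ,
      ‖((coeff j (H m') : 𝓞_ℂ_[p]) : ℂ_[p]) - ((coeff j (H m) : 𝓞_ℂ_[p]) : ℂ_[p])‖ ≤ ((p : ℝ)⁻¹) ^ m) :
    ∃ Hinf : PowerSeries 𝓞_ℂ_[p], ∀ m j : ℕ,
      ‖((coeff j Hinf : 𝓞_ℂ_[p]) : ℂ_[p]) - ((coeff j (H m) : 𝓞_ℂ_[p]) : ℂ_[p])‖ ≤ ((p : ℝ)⁻¹) ^ m := by
  have hp1 : ((p : ℝ)⁻¹) < 1 := inv_lt_one_of_one_lt₀ (by exact_mod_cast hp.out.one_lt)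
  have hp0 : 0 ≤ ((p : ℝ)⁻¹) := inv_nonneg.mpr (Nat.cast_nonneg _)
  -- the coefficient sequences
  set s : ℕ → ℕ → ℂ_[p] := fun j m ↦ ((coeff j (H m) : 𝓞_ℂ_[p]) : ℂ_[p]) with hs
  have hcauchy : ∀ j, CauchySeq (s j) := by
    intro j
    refine Metric.cauchySeq_iff'.mpr fun ε hε ↦ ?_
    obtain ⟨N, hN⟩ := exists_pow_lt_of_lt_one hε hp1
    refine ⟨N, fun n hn ↦ ?_⟩
    rw [dist_eq_norm]
    exact (hH N n hn j).trans_lt hN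
  choose c hc using fun j ↦ cauchySeq_tendsto_of_complete (hcauchy j)
  -- bounds in the limit
  have hbound : ∀ m j, ‖c j - s j m‖ ≤ ((p : ℝ)⁻¹) ^ m := by
    intro m j
    have ht : Tendsto (fun n ↦ ‖s j n - s j m‖) atTop (𝓝 ‖c j - s j m‖) :=
      ((hc j).sub_const (s j m)).norm
    refine le_of_tendsto ht (Filter.eventually_atTop.mpr ⟨m, fun n hn ↦ ?_⟩)
    exact hH m n hn j
  have hone : ∀ j, ‖c j‖ ≤ 1 := by
    intro j
    have ht : Tendsto (fun n ↦ ‖s j n‖) atTop (𝓝 ‖c j‖) := (hc j).norm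
    exact le_of_tendsto' ht fun n ↦ norm_coeff_le_one (H n) j
  refine ⟨PowerSeries.mk fun j ↦ ⟨c j, mem_unitBall.mpr (hone j)⟩, fun m j ↦ ?_⟩
  rw [PowerSeries.coeff_mk]
  exact hbound m j

/-- **The analytic Krull step over `𝓞_{ℂ_p}⟦T⟧`**: if `Q` has a (first) unit coefficient, the
principal ideal `(Q)` is closed for `p`-adic congruences — `G ∈ (Q) + (p)^m` for every `m` implies
`G ∈ (Q)`. Proof: write `G = Q·H_m + p^m·R_m`; by the coefficientwise Gauss lemma
(`norm_coeff_le_of_forall_norm_coeff_mul_le`, p420633) the `H_m` are `p`-adically Cauchy; their limit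
`H∞` (completeness of `ℂ_p`) satisfies `G − Q·H∞ ≡ 0 (mod p^m)` for all `m`, hence `G = Q·H∞`.
Replaces `iInf_sup_pow_eq_self` (Noetherian rings) on the wide receptacle.
[cite: BoschGuntzerRemmert1984, §5.1.2 Prop. 1] -/
theorem mem_span_of_forall_mem_sup_pow {Q G : PowerSeries 𝓞_ℂ_[p]} {n : ℕ}
    (hQ : (‖((coeff n Q : 𝓞_ℂ_[p]) : ℂ_[p])‖ = 1 ∧ ∀ i < n, ‖((coeff i Q : 𝓞_ℂ_[p]) : ℂ_[p])‖ < 1))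
    (h : ∀ m : ℕ,
      G ∈ Ideal.span {Q} ⊔ Ideal.span {(C ((p : ℕ) : 𝓞_ℂ_[p]) : PowerSeries 𝓞_ℂ_[p])} ^ m) :
    G ∈ Ideal.span ({Q} : Set (PowerSeries 𝓞_ℂ_[p])) := by
  choose H R hHR using fun m ↦ exists_eq_mul_add_of_mem_sup_pow (h m)
  -- the quotients are `p`-adically Cauchy, coefficientwise (Gauss)
  have hcauchy : ∀ m m' : ℕ, m ≤ m' → ∀ j : ℕ,
      ‖((coeff j (H m') : 𝓞_ℂ_[p]) : ℂ_[p]) - ((coeff j (H m) : 𝓞_ℂ_[p]) : ℂ_[p])‖ ≤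
        ((p : ℝ)⁻¹) ^ m := by
    intro m m' hmm' j
    have hprod : Q * (H m' - H m) =
        C (((p : ℕ) : 𝓞_ℂ_[p]) ^ m) * (R m - C (((p : ℕ) : 𝓞_ℂ_[p]) ^ (m' - m)) * R m') := by
      have e1 := hHR m
      have e2 := hHR m'
      have hpow : C (((p : ℕ) : 𝓞_ℂ_[p]) ^ m') =
          C (((p : ℕ) : 𝓞_ℂ_[p]) ^ m) * C (((p : ℕ) : 𝓞_ℂ_[p]) ^ (m' - m)) := by
        rw [← map_mul, ← pow_add, Nat.add_sub_cancel' hmm']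
      rw [hpow] at e2
      linear_combination e1 - e2
    have hle : ∀ k, ‖((coeff k (Q * (H m' - H m)) : 𝓞_ℂ_[p]) : ℂ_[p])‖ ≤ ((p : ℝ)⁻¹) ^ m := by
      intro k; rw [hprod]; exact norm_coeff_C_pow_mul_le _ m k
    have hj := norm_coeff_le_of_forall_norm_coeff_mul_le hQ hle j
    rwa [map_sub, AddSubgroupClass.coe_sub] at hj
  obtain ⟨Hinf, hHinf⟩ := exists_limit_of_coeff_cauchy H hcauchy
  -- `H∞ − H m = p^m · S m`
  have hdiv : ∀ m, ∃ S : PowerSeries 𝓞_ℂ_[p], Hinf - H m = C (((p : ℕ) : 𝓞_ℂ_[p]) ^ m) * S := by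
    intro m
    have hp0 : ((((p : ℕ) : 𝓞_ℂ_[p]) ^ m : 𝓞_ℂ_[p]) : ℂ_[p]) ≠ 0 := by
      push_cast; exact pow_ne_zero _ (by exact_mod_cast hp.out.ne_zero)
    refine exists_eq_C_mul_of_forall_norm_le hp0 fun j ↦ ?_
    rw [norm_coe_natCast_p_pow, map_sub, AddSubgroupClass.coe_sub]
    exact hHinf m j
  -- `G − Q·H∞ ≡ 0 (mod p^m)` for every `m`
  have hzero : G - Q * Hinf = 0 := by
    refine eq_zero_of_forall_norm_coeff_le_pow fun m j ↦ ?_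
    obtain ⟨S, hS⟩ := hdiv m
    have hGQ : G - Q * Hinf = C (((p : ℕ) : 𝓞_ℂ_[p]) ^ m) * (R m - Q * S) := by
      have e1 := hHR m
      linear_combination e1 - Q * hS
    rw [hGQ]
    exact norm_coeff_C_pow_mul_le _ m j
  rw [sub_eq_zero] at hzero
  rw [hzero]
  exact Ideal.mul_mem_right _ _ (Ideal.mem_span_singleton_self Q)

end Summit.BirchSwinnertonDyer.Rank1Residual.X2.CpIntSeries

/-! ## §2 The one-sided REVERSE congruence limit across `Λ → 𝓞_{ℂ_p}⟦T⟧` -/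

namespace Summit.BirchSwinnertonDyer.Rank1Residual.X2.HidaLimitAlgebra

variable {p : ℕ} [hp : Fact p.Prime]

/-- `map toCpInt` sends `(p) ⊆ Λ` to `(p) ⊆ 𝓞_{ℂ_p}⟦T⟧`. [folklore] -/
theorem map_span_C_p_int :
    (Ideal.span {(C (p : ℤ_[p]) : IwasawaAlgebra p)}).map (PowerSeries.map (R1.toCpInt p)) =
      Ideal.span {(C ((p : ℕ) : 𝓞_ℂ_[p]) : PowerSeries 𝓞_ℂ_[p])} := by
  rw [Ideal.map_span, Set.image_singleton, PowerSeries.map_C, map_natCast]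

/-- **Road H's output from road H's inputs over the WIDE receptacle, in the kernel.** As
`C_pow_mul_map_mem_span_of_oneSided_congruences` (p428978) with `S = 𝓞_{ℂ_p}⟦T⟧`, the frame `Q` and
member series `Q_m` in `𝓞_{ℂ_p}⟦T⟧`, and ONE extra input — `Q` has a (first) unit coefficient (KY D′♭:
`μ = 0`) — which replaces Noetherianity in the limit (§1). Conclusion: `C(p^a)·F♭ ∈ (Q)`, the body
of `X2.HidaLimitRevDivOnTreeInt` (p429473) at the datum. Pure algebra/analysis; nothing about any
curve. [cite: KellerYin2024, §5.1 (a)–(e) and Lemma 5.1.2 (arXiv:2402.12781v2) (shape only)]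
[cite: Skinner2016PacificMC, §3.1 (p. 192)] [cite: BoschGuntzerRemmert1984, §5.1.2 Prop. 1] -/
theorem C_pow_mul_map_mem_span_of_oneSided_congruences_int
    {M : Type*} [AddCommGroup M] [Module (IwasawaAlgebra p) M] [Module.Finite (IwasawaAlgebra p) M]
    (N : ℕ → Type*) [∀ m, AddCommGroup (N m)] [∀ m, Module (IwasawaAlgebra p) (N m)]
    [∀ m, Module.Finite (IwasawaAlgebra p) (N m)]
    {F : IwasawaAlgebra p} {a : ℕ}
    (hfitt : Ideal.span {(C (p : ℤ_[p]) : IwasawaAlgebra p)} ^ a * Ideal.span {F} ≤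
      Module.fittingIdeal (IwasawaAlgebra p) M 0)
    {Q : PowerSeries 𝓞_ℂ_[p]} {n : ℕ}
    (hQ : (‖((coeff n Q : 𝓞_ℂ_[p]) : ℂ_[p])‖ = 1 ∧ ∀ i < n, ‖((coeff i Q : 𝓞_ℂ_[p]) : ℂ_[p])‖ < 1))
    (Qm : ℕ → PowerSeries 𝓞_ℂ_[p])
    (e : ∀ m : ℕ, 1 ≤ m →
      ((M ⧸ ((Ideal.span {(C (p : ℤ_[p]) : IwasawaAlgebra p)}) ^ m •
          (⊤ : Submodule (IwasawaAlgebra p) M))) ≃ₗ[IwasawaAlgebra p]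
        (N m ⧸ ((Ideal.span {(C (p : ℤ_[p]) : IwasawaAlgebra p)}) ^ m •
          (⊤ : Submodule (IwasawaAlgebra p) (N m))))))
    (hF : ∀ m : ℕ, 1 ≤ m →
      (Module.fittingIdeal (IwasawaAlgebra p) (N m) 0).map (PowerSeries.map (R1.toCpInt p)) ≤
        Ideal.span {Qm m})
    (hc : ∀ m : ℕ, 1 ≤ m →
      Ideal.span {Qm m} ⊔ (Ideal.span {(C ((p : ℕ) : 𝓞_ℂ_[p]) : PowerSeries 𝓞_ℂ_[p])}) ^ m =
        Ideal.span {Q} ⊔ (Ideal.span {(C ((p : ℕ) : 𝓞_ℂ_[p]) : PowerSeries 𝓞_ℂ_[p])}) ^ m) :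
    C (((p : ℕ) : 𝓞_ℂ_[p]) ^ a) * PowerSeries.map (R1.toCpInt p) F ∈
      Ideal.span ({Q} : Set (PowerSeries 𝓞_ℂ_[p])) := by
  set φ : IwasawaAlgebra p →+* PowerSeries 𝓞_ℂ_[p] := PowerSeries.map (R1.toCpInt p) with hφ
  set I : Ideal (IwasawaAlgebra p) := Ideal.span {(C (p : ℤ_[p]) : IwasawaAlgebra p)} with hI
  have hIφ : I.map φ = Ideal.span {(C ((p : ℕ) : 𝓞_ℂ_[p]) : PowerSeries 𝓞_ℂ_[p])} :=
    map_span_C_p_int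
  -- the element lies in `φ((p)^a·(F))`
  have hmem : C (((p : ℕ) : 𝓞_ℂ_[p]) ^ a) * φ F ∈ (I ^ a * Ideal.span {F}).map φ := by
    rw [Ideal.map_mul, Ideal.map_pow, hIφ, Ideal.map_span, Set.image_singleton,
      Ideal.span_singleton_pow, ← map_pow]
    exact Ideal.mul_mem_mul (Ideal.mem_span_singleton_self _) (Ideal.mem_span_singleton_self _)
  -- one-sided congruences for every `m`
  refine CpIntSeries.mem_span_of_forall_mem_sup_pow hQ fun m ↦ ?_
  rcases Nat.eq_zero_or_pos m with rfl | hm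
  · rw [pow_zero, Ideal.one_eq_top, sup_top_eq]; exact Submodule.mem_top
  · have hstep := map_fittingIdeal_le_sup_of_congruence φ I N (L := Q) (e m hm) (hF m hm)
      (by rw [hIφ]; exact hc m hm)
    rw [hIφ] at hstep
    exact hstep ((Ideal.map_mono hfitt) hmem)

end Summit.BirchSwinnertonDyer.Rank1Residual.X2.HidaLimitAlgebra

end
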